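import Literature.NumberTheory.LFunctions.SiegelZeroRealZeroIsolation
import Literature.NumberTheory.LFunctions.CentralValueNonnegativityClassNumberBound
import Literature.NumberTheory.LFunctions.DeuringZeroSpacingPhenomenon
import Literature.NumberTheory.LFunctions.RHWave0
import HarnessLib

/-!
# The one-point exits discharged under GRH (kernel, explicit): `GRH ⇒ h(−d) ≥ 1 + d^{1/4}(log d − 2 log 2 − 4)/(4√2)`
# and `GRH ⇒ h(−d) ≥ √d/(2e log d) − 5`; and the central-value exit kills Watkins' exceptional character

Topic `Literature/NumberTheory/LFunctions` (namespace `Literature.NumberTheory.LFunctions`, sub-namespace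
`RealPointExit`). Everything in this file is PROVED (theorems only; no definition, no named fact, debt 0); the
Generalized Riemann Hypothesis enters only as an ANTECEDENT (the tree's open-strip `GeneralizedRiemannHypothesis`,
`RHWave0.lean`). Cell `parity-realchar` (SIEGEL INSTRUMENT, conditionals column (3)): closes the loop on the
one-point exits of `CentralValueNonnegativityClassNumberBound.lean` / `RealPointNonnegativityClassNumberBound.lean` /
`SiegelZeroRealZeroIsolation.lean` by exhibiting the standard hypothesis under which every one-point antecedent
`L(σ, χ) ≥ 0` (`½ ≤ σ < 1`) holds, and links the central-value exit to Watkins' Deuring zero-spacing predicate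
(`DeuringZeroSpacingPhenomenon.lean`).

* `LFunction_ofReal_re_pos_of_GRH` — GRH ⇒ `Re L(σ, χ) > 0` for `½ < σ ≤ 1` (quadratic `χ ≠ 1`: no zero on
  `[σ, 1]`, tree `DirichletAbel.LFunction_ofReal_re_pos_of_forall_ne_zero`); `LFunction_half_re_nonneg_of_GRH` —
  GRH ⇒ `Re L(½, χ) ≥ 0` (continuity at `½`; GRH allows a zero AT `½`).
* `classNumber_ge_of_GRH_half` — **GRH ⇒ `h_K ≥ 1 + d^{1/4}(log d − 2 log 2 − 4)/(4√2)`**;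
  `classNumber_ge_of_GRH_ofReal` — the whole `σ`-family; `classNumber_ge_of_GRH_heckePoint(')` —
  **GRH ⇒ `h_K ≥ √d/(4e log(√d/2)) − 5 ≥ √d/(2e log d) − 5`** (`√d/2 ≥ e⁴`): an explicit, effective, kernel-proved
  class-number lower bound under GRH (print: Littlewood 1928 / Lamzouri–Li–Soundararajan 2015 give the true GRH
  order `h(−d) ≫ √d/log log d`; NOT in the tree and NOT claimed here — the `log d` loss is the price of the
  one-point method; the tree's kernel Hecke lemma under GRH would give `√d/(8π log d)`, a constant `4.6×` smaller).
* `not_isExceptional_of_LFunction_half_nonneg` — **for an ODD real primitive `χ` mod `D ≥ 3`: `L(½, χ) ≥ 0 ⇒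
  ¬ Watkins2021.IsExceptional χ`** (`√D L(1,χ) = π h_K ≥ π(1 + D^{1/4}(log D − 5.39)/(4√2)) > D^{1/6}` once
  `log D > 625`; below `e^{625}` the tree's unconditional `Watkins2021.not_isExceptional`): Watkins' exceptional
  character, if it exists, has a NEGATIVE central value; `not_isExceptional_of_GRH` — under GRH there is none (odd).

LABEL (cell rule): conditionals II (GRH-discharge of the one-point antecedents; explicit effective `h` under GRH) +
dictionary link I.10 (Watkins) ↔ II.X, kernel. WHAT THIS IS NOT: no unconditional statement about any `h(−d)` beyond
the tree's; nothing here bears on parity (H5).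

## References (context)

* [IwaniecConversations2006] §4 (4.23)–(4.25), §5.
* [Watkins2021DeuringZeroSpacing] Theorem 1.1 (the predicate `IsExceptional`).
* [MontgomeryVaughan2007] §11.2 (Hecke), §13 (GRH consequences, context).
-/

noncomputable section

open Complex Filter Topology Set
open Literature.Barriers.Parity
open Literature.NumberTheory.QuadraticFields Literature.NumberTheory.QuadraticFields.Quadratic
open _root_.NumberField Module

namespace Literature.NumberTheory.LFunctions

namespace RealPointExit

/-! ### GRH discharges the one-point antecedents -/

/-- **GRH ⇒ `Re L(σ, χ) > 0` for `½ < σ ≤ 1`** (`χ` quadratic, `χ ≠ 1`): under the open-strip GRH, `L(s, χ)` has no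
zero with `½ < Re s < 1`, none at `s = 1`, so none on `[σ, 1]`, and the real-valued `L` is positive there
(tree `DirichletAbel.LFunction_ofReal_re_pos_of_forall_ne_zero`). [cite: MontgomeryVaughan2007, §11.2 Theorem 11.4] -/
theorem LFunction_ofReal_re_pos_of_GRH (hGRH : GeneralizedRiemannHypothesis) {d : ℕ} [NeZero d]
    {χ : DirichletCharacter ℂ d} (hχ : χ ≠ 1) (hquad : χ.IsQuadratic) {σ : ℝ} (hσ : 1 / 2 < σ) (hσ1 : σ ≤ 1) :
    0 < (χ.LFunction (σ : ℂ)).re := by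
  refine DirichletAbel.LFunction_ofReal_re_pos_of_forall_ne_zero χ hχ hquad.sq_eq_one (by linarith) hσ1 ?_
  intro σ' h1 h2 h0
  rcases eq_or_lt_of_le h2 with h | h
  · rw [h] at h0
    exact χ.LFunction_apply_one_ne_zero hχ (by exact_mod_cast h0)
  · have := hGRH d χ (σ' : ℂ) h0 (by simp; linarith) (by simp; exact h)
    simp at this
    linarith

/-- **GRH ⇒ `Re L(½, χ) ≥ 0`** (`χ` quadratic, `χ ≠ 1`): `Re L(σ, χ) > 0` for `σ ∈ (½, 1]` and continuity at `½`
(GRH permits a zero AT `s = ½`, so only `≥ 0`). [cite: MontgomeryVaughan2007, §11.2 Theorem 11.4] -/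
theorem LFunction_half_re_nonneg_of_GRH (hGRH : GeneralizedRiemannHypothesis) {d : ℕ} [NeZero d]
    {χ : DirichletCharacter ℂ d} (hχ : χ ≠ 1) (hquad : χ.IsQuadratic) :
    0 ≤ (χ.LFunction (1 / 2)).re := by
  set g : ℝ → ℝ := fun σ => (χ.LFunction (σ : ℂ)).re with hg
  have hcont : Continuous g :=
    continuous_re.comp ((DirichletCharacter.differentiable_LFunction hχ).continuous.comp continuous_ofReal)
  have hhalf : ((1 / 2 : ℝ) : ℂ) = 1 / 2 := by push_cast; rfl
  have hg12 : g (1 / 2) = (χ.LFunction (1 / 2)).re := by simp only [hg, hhalf]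
  rw [← hg12]
  by_contra hneg
  push Not at hneg
  -- `g < 0` near `½`, contradicting positivity just right of `½`
  have hev : ∀ᶠ σ in nhds (1 / 2 : ℝ), g σ < 0 :=
    (hcont.continuousAt (x := 1 / 2)).eventually (gt_mem_nhds hneg)
  obtain ⟨ε, hε, hball⟩ := Metric.eventually_nhds_iff.1 hev
  set σ : ℝ := 1 / 2 + min (ε / 2) (1 / 4) with hσdef
  have hmin1 : min (ε / 2) (1 / 4) ≤ ε / 2 := min_le_left _ _
  have hmin2 : min (ε / 2) (1 / 4) ≤ 1 / 4 := min_le_right _ _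
  have hmin0 : 0 < min (ε / 2) (1 / 4) := lt_min (by linarith) (by norm_num)
  have hσgt : 1 / 2 < σ := by rw [hσdef]; linarith
  have hσle : σ ≤ 1 := by rw [hσdef]; linarith
  have hdist : dist σ (1 / 2) < ε := by
    rw [Real.dist_eq, hσdef, show 1 / 2 + min (ε / 2) (1 / 4) - 1 / 2 = min (ε / 2) (1 / 4) by ring,
      abs_of_pos hmin0]
    linarith
  have h1 := hball hdist
  have h2 := LFunction_ofReal_re_pos_of_GRH hGRH hχ hquad hσgt hσle
  simp only [hg] at h1
  linarith

variable {K : Type*} [Field K] [NumberField K]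

/-- An odd character is non-trivial. [folklore] -/
private theorem ne_one_of_odd {d : ℕ} [NeZero d] {χ : DirichletCharacter ℂ d} (hodd : χ.Odd) : χ ≠ 1 := by
  intro h
  have h1 : χ (-1) = -1 := hodd
  rw [h, MulChar.one_apply (isUnit_one.neg)] at h1
  norm_num at h1

/-- **GRH ⇒ `h_K ≥ 1 + d^{1/4}(log d − 2 log 2 − 4)/(4√2)`** for every imaginary quadratic field `K` with
`d_K = −d`, `d > 4` (`χ` the odd real primitive character mod `d`): the central-value exit
`CentralValueExit.classNumber_ge_of_LFunction_half_nonneg` with its antecedent supplied by GRH.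
[cite: IwaniecConversations2006, §4 (4.23)–(4.25)] -/
theorem classNumber_ge_of_GRH_half (hGRH : GeneralizedRiemannHypothesis) (h2 : finrank ℚ K = 2) {d : ℕ}
    [NeZero d] (hdK : NumberField.discr K = -(d : ℤ)) (hd : 4 < d) {χ : DirichletCharacter ℂ d}
    (hprim : χ.IsPrimitive) (hquad : χ.IsQuadratic) (hodd : χ.Odd) :
    1 + (d : ℝ) ^ (1 / 4 : ℝ) * (Real.log d - 2 * Real.log 2 - 4) / (4 * Real.sqrt 2) ≤ (classNumber K : ℝ) :=
  CentralValueExit.classNumber_ge_of_LFunction_half_nonneg h2 hdK hd hprim hquad hodd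
    (LFunction_half_re_nonneg_of_GRH hGRH (ne_one_of_odd hodd) hquad)

/-- **GRH ⇒ the whole one-point family**: for every `σ ∈ (½, 1)`,
`h_K ≥ 1 + σ(1−σ)[2y^σ(1/(2σ−1) − 1/(2σ)) − 2y^{1−σ}(1/(2−2σ) + 1/(2σ−1)) − 1]`, `y = √d/2`.
[cite: IwaniecConversations2006, §5] -/
theorem classNumber_ge_of_GRH_ofReal (hGRH : GeneralizedRiemannHypothesis) (h2 : finrank ℚ K = 2) {d : ℕ}
    [NeZero d] (hdK : NumberField.discr K = -(d : ℤ)) (hd : 4 < d) {χ : DirichletCharacter ℂ d}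
    (hprim : χ.IsPrimitive) (hquad : χ.IsQuadratic) (hodd : χ.Odd) {σ : ℝ} (hσ : 1 / 2 < σ) (hσ1 : σ < 1) :
    1 + σ * (1 - σ) * (2 * (Real.sqrt d / 2) ^ σ * (1 / (2 * σ - 1) - 1 / (2 * σ)) -
        2 * (Real.sqrt d / 2) ^ (1 - σ) * (1 / (2 - 2 * σ) + 1 / (2 * σ - 1)) - 1) ≤
      (classNumber K : ℝ) :=
  classNumber_ge_of_LFunction_ofReal_nonneg h2 hdK hd hprim hquad hodd hσ hσ1
    (LFunction_ofReal_re_pos_of_GRH hGRH (ne_one_of_odd hodd) hquad hσ hσ1.le).le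

/-- **GRH ⇒ `h_K ≥ √d/(4e log(√d/2)) − 5`** (`√d/2 ≥ e⁴`): the Hecke point of the one-point family under GRH — an
explicit effective class-number lower bound of the order `√d/log d` in the kernel (print, not in the tree:
Littlewood's GRH order `√d/log log d`). [cite: MontgomeryVaughan2007, §11.2 Theorem 11.4]
[cite: IwaniecConversations2006, §5] -/
theorem classNumber_ge_of_GRH_heckePoint (hGRH : GeneralizedRiemannHypothesis) (h2 : finrank ℚ K = 2) {d : ℕ}
    [NeZero d] (hdK : NumberField.discr K = -(d : ℤ)) (hd : Real.exp 4 ≤ Real.sqrt d / 2)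
    {χ : DirichletCharacter ℂ d} (hprim : χ.IsPrimitive) (hquad : χ.IsQuadratic) (hodd : χ.Odd) :
    Real.sqrt d / (4 * Real.exp 1 * Real.log (Real.sqrt d / 2)) - 5 ≤ (classNumber K : ℝ) := by
  have he4 : (1 : ℝ) < Real.exp 4 := by have := Real.add_one_le_exp (4 : ℝ); linarith
  have hy1 : 1 < Real.sqrt d / 2 := lt_of_lt_of_le he4 hd
  have hL4 : 4 ≤ Real.log (Real.sqrt d / 2) := by
    rw [Real.le_log_iff_exp_le (by linarith)]; exact hd
  have hσ : 1 / 2 < 1 - 1 / Real.log (Real.sqrt d / 2) := by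
    have : 1 / Real.log (Real.sqrt d / 2) ≤ 1 / 4 := one_div_le_one_div_of_le (by norm_num) hL4
    linarith
  have hσ1 : 1 - 1 / Real.log (Real.sqrt d / 2) ≤ 1 := by
    have : 0 < 1 / Real.log (Real.sqrt d / 2) := by positivity
    linarith
  exact classNumber_ge_of_LFunction_heckePoint_nonneg h2 hdK hd hprim hquad hodd
    (LFunction_ofReal_re_pos_of_GRH hGRH (ne_one_of_odd hodd) hquad hσ hσ1).le

/-- **GRH ⇒ `h_K ≥ √d/(2e log d) − 5`** (`√d/2 ≥ e⁴`, i.e. `d ≥ 4e⁸`). [cite: MontgomeryVaughan2007, §11.2 Theorem 11.4]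
[cite: IwaniecConversations2006, §5] -/
theorem classNumber_ge_of_GRH_heckePoint' (hGRH : GeneralizedRiemannHypothesis) (h2 : finrank ℚ K = 2) {d : ℕ}
    [NeZero d] (hdK : NumberField.discr K = -(d : ℤ)) (hd : Real.exp 4 ≤ Real.sqrt d / 2)
    {χ : DirichletCharacter ℂ d} (hprim : χ.IsPrimitive) (hquad : χ.IsQuadratic) (hodd : χ.Odd) :
    Real.sqrt d / (2 * Real.exp 1 * Real.log d) - 5 ≤ (classNumber K : ℝ) := by
  have he4 : (1 : ℝ) < Real.exp 4 := by have := Real.add_one_le_exp (4 : ℝ); linarith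
  have hy1 : 1 < Real.sqrt d / 2 := lt_of_lt_of_le he4 hd
  have hL4 : 4 ≤ Real.log (Real.sqrt d / 2) := by
    rw [Real.le_log_iff_exp_le (by linarith)]; exact hd
  have hσ : 1 / 2 < 1 - 1 / Real.log (Real.sqrt d / 2) := by
    have : 1 / Real.log (Real.sqrt d / 2) ≤ 1 / 4 := one_div_le_one_div_of_le (by norm_num) hL4
    linarith
  have hσ1 : 1 - 1 / Real.log (Real.sqrt d / 2) ≤ 1 := by
    have : 0 < 1 / Real.log (Real.sqrt d / 2) := by positivity
    linarith
  exact classNumber_ge_of_LFunction_heckePoint_nonneg' h2 hdK hd hprim hquad hodd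
    (LFunction_ofReal_re_pos_of_GRH hGRH (ne_one_of_odd hodd) hquad hσ hσ1).le

/-- **GRH ⇒ the `κ`-family at `σ = 1 − κ/log(√d/2)`**: `h_K ≥ κe^{−κ}(√d/2)/(2 log(√d/2)) − 2e^{κ} + ¾` for every
`0 < κ ≤ ¼ log(√d/2)`. [cite: IwaniecConversations2006, §5] -/
theorem classNumber_ge_of_GRH_at (hGRH : GeneralizedRiemannHypothesis) (h2 : finrank ℚ K = 2) {d : ℕ}
    [NeZero d] (hdK : NumberField.discr K = -(d : ℤ)) {χ : DirichletCharacter ℂ d}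
    (hprim : χ.IsPrimitive) (hquad : χ.IsQuadratic) (hodd : χ.Odd) {κ : ℝ} (hκ : 0 < κ)
    (hL : 4 * κ ≤ Real.log (Real.sqrt d / 2)) :
    κ * Real.exp (-κ) * (Real.sqrt d / 2) / (2 * Real.log (Real.sqrt d / 2)) - 2 * Real.exp κ + 3 / 4 ≤
      (classNumber K : ℝ) := by
  have hlog : 0 < Real.log (Real.sqrt d / 2) := by linarith
  have hσ : 1 / 2 < 1 - κ / Real.log (Real.sqrt d / 2) := by
    have : κ / Real.log (Real.sqrt d / 2) ≤ 1 / 4 := by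
      rw [div_le_div_iff₀ hlog (by norm_num)]; linarith
    linarith
  have hσ1 : 1 - κ / Real.log (Real.sqrt d / 2) ≤ 1 := by
    have : 0 < κ / Real.log (Real.sqrt d / 2) := by positivity
    linarith
  exact classNumber_ge_of_LFunction_nonneg_at h2 hdK hprim hquad hodd hκ hL
    (LFunction_ofReal_re_pos_of_GRH hGRH (ne_one_of_odd hodd) hquad hσ hσ1).le

/-! ### Watkins' exceptional character has a negative central value -/

/-- **`L(½, χ) ≥ 0 ⇒ ¬ Watkins2021.IsExceptional χ`** for an ODD real primitive `χ` mod `D ≥ 3`: Watkins' hypothesis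
`√D L(1,χ) ≤ D^{1/6}e^{−(log D)^{3/4}}` is refuted unconditionally for `D ≤ e^{625}` by the tree
(`Watkins2021.not_isExceptional`, class number formula alone), and for `log D > 625` by the central-value exit:
`√D L(1,χ) = π h_K ≥ π(1 + D^{1/4}(log D − 2 log 2 − 4)/(4√2)) > D^{1/4} ≥ D^{1/6} ≥ D^{1/6}e^{−(log D)^{3/4}}`.
So Watkins' exceptional character (the antecedent of the Deuring zero-spacing theorem), if it exists, has
`L(½, χ) < 0`. [cite: Watkins2021DeuringZeroSpacing, Theorem 1.1] [cite: IwaniecConversations2006, §4 (4.23)–(4.25)] -/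
theorem not_isExceptional_of_LFunction_half_nonneg {D : ℕ} [NeZero D] (hD : 3 ≤ D)
    {χ : DirichletCharacter ℂ D} (hprim : χ.IsPrimitive) (hquad : χ.IsQuadratic) (hodd : χ.Odd)
    (hL : 0 ≤ (χ.LFunction (1 / 2)).re) : ¬ Watkins2021.IsExceptional χ := by
  by_cases h625 : Real.log D ≤ 625
  · exact Watkins2021.not_isExceptional hD h625 hprim hquad
  push Not at h625
  have hD0 : (0 : ℝ) < D := by exact_mod_cast (show 0 < D by omega)
  -- `D > 4`: `log D > 625 > log 4`
  have hD4 : 4 < D := by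
    by_contra hcon
    push Not at hcon
    have : Real.log D ≤ Real.log 4 := Real.log_le_log hD0 (by exact_mod_cast hcon)
    have h4 : Real.log 4 < 625 := by
      have : Real.log 4 ≤ 4 - 1 := by
        have := Real.log_le_sub_one_of_pos (show (0:ℝ) < 4 by norm_num); linarith
      linarith
    linarith
  obtain ⟨K, _i1, _i2, h2, hdK⟩ := exists_quadraticField_of_odd_primitive hprim hquad hodd
  have hh := CentralValueExit.classNumber_ge_of_LFunction_half_nonneg h2 hdK hD4 hprim hquad hodd hL
  have hnorm := SiegelZeroClassNumber.norm_lOne_eq_of_odd h2 hdK hD4 hprim hquad hodd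
  intro hex
  unfold Watkins2021.IsExceptional Watkins2021.H at hex
  have hsD : 0 < Real.sqrt D := Real.sqrt_pos.2 hD0
  -- `√D ‖L(1,χ)‖ = π h_K`
  have hH : Real.sqrt D * ‖χ.LFunction 1‖ = Real.pi * classNumber K := by
    rw [hnorm]; field_simp
  rw [hH] at hex
  -- right side `≤ D^{1/6} ≤ D^{1/4}`
  have hexp1 : Real.exp (-(Real.log D ^ (3 / 4 : ℝ))) ≤ 1 := by
    rw [Real.exp_le_one_iff, neg_nonpos]
    exact Real.rpow_nonneg (by linarith) _
  have hD1 : (1 : ℝ) ≤ D := by exact_mod_cast (show 1 ≤ D by omega)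
  have hpow : (D : ℝ) ^ (1 / 6 : ℝ) ≤ (D : ℝ) ^ (1 / 4 : ℝ) :=
    Real.rpow_le_rpow_of_exponent_le hD1 (by norm_num)
  have hpos6 : 0 ≤ (D : ℝ) ^ (1 / 6 : ℝ) := Real.rpow_nonneg hD0.le _
  have hrhs : (D : ℝ) ^ (1 / 6 : ℝ) * Real.exp (-(Real.log D ^ (3 / 4 : ℝ))) ≤ (D : ℝ) ^ (1 / 4 : ℝ) := by
    calc (D : ℝ) ^ (1 / 6 : ℝ) * Real.exp (-(Real.log D ^ (3 / 4 : ℝ))) ≤ (D : ℝ) ^ (1 / 6 : ℝ) * 1 :=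
          mul_le_mul_of_nonneg_left hexp1 hpos6
      _ ≤ (D : ℝ) ^ (1 / 4 : ℝ) := by rw [mul_one]; exact hpow
  -- left side `π h_K ≥ π (1 + D^{1/4}(log D − 5.39)/(4√2)) > D^{1/4}`
  have hl2 := Real.log_two_lt_d9
  have hs2 : Real.sqrt 2 < 1.4143 := by
    rw [Real.sqrt_lt' (by norm_num)]; norm_num
  have hs20 : 0 < Real.sqrt 2 := Real.sqrt_pos.2 two_pos
  have hr0 : 0 < (D : ℝ) ^ (1 / 4 : ℝ) := Real.rpow_pos_of_pos hD0 _
  have hbig : (D : ℝ) ^ (1 / 4 : ℝ) * (Real.log D - 2 * Real.log 2 - 4) / (4 * Real.sqrt 2) ≥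
      (D : ℝ) ^ (1 / 4 : ℝ) * 100 := by
    rw [ge_iff_le, le_div_iff₀ (by positivity)]
    have h1 : 600 ≤ Real.log D - 2 * Real.log 2 - 4 := by linarith
    nlinarith
  have hpi := Real.pi_gt_three
  have hlhs : (D : ℝ) ^ (1 / 4 : ℝ) < Real.pi * classNumber K := by nlinarith
  linarith

/-- **GRH ⇒ no odd real primitive character is exceptional in Watkins' sense** (all conductors `D ≥ 3`).
[cite: Watkins2021DeuringZeroSpacing, Theorem 1.1] -/
theorem not_isExceptional_of_GRH (hGRH : GeneralizedRiemannHypothesis) {D : ℕ} [NeZero D] (hD : 3 ≤ D)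
    {χ : DirichletCharacter ℂ D} (hprim : χ.IsPrimitive) (hquad : χ.IsQuadratic) (hodd : χ.Odd) :
    ¬ Watkins2021.IsExceptional χ :=
  not_isExceptional_of_LFunction_half_nonneg hD hprim hquad hodd
    (LFunction_half_re_nonneg_of_GRH hGRH (ne_one_of_odd hodd) hquad)

end RealPointExit

end Literature.NumberTheory.LFunctions

end
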